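import Summits.QuantumFields.YangMills.Theses.FradkinShenkerFlow
import Literature.Probability.LatticeModels.GibbsSpecificationTilted
import Literature.Probability.Moments.EfronSteinProofs
import Summits.QuantumFields.YangMills.Theorems.FradkinShenkerFlowSusceptibilityToPoincareLocalPoincareKernelVariance

/-!
# Efron–Stein in a sparse Gibbsian kernel
# (stub `stub_gibbsSparseEfronStein`, line `planted-link-pinning`, crux `SusceptibilityToPoincare`)

Route `FradkinShenkerFlow` of `YangMills`, crux item `stmt-QuantumFields-9441`
(`Summit.QuantumFields.YangMills.Theses.FradkinShenkerFlow.SusceptibilityToPoincare`, FS ⇒ UP).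
Helper file (supports the item, closes nothing) proving the registered stub T0
`stub_gibbsSparseEfronStein` of the skeleton
`Cruxes/SusceptibilityToPoincare/Lines/planted_link_pinning.lean`: the TERMINAL STAGE of the
planted-link-pinning line in its abstract form, for the Gibbsian specification
`γ_Λ(· | η) = (ν^{⊗Λ} ∘ glueWith⁻¹(·, η)).tilted (-β H_Λ^Φ)` of ANY bounded adapted potential
`Φ` supported by finite families `supp` (Georgii 2011, Def. 2.9; tree `gibbsSpecOfPotential`).

If the finite volume `Λ` is SPARSE — every interaction set `A ∈ supp Λ` meets `Λ` in at most one
site — then under `γ_Λ(· | η)` the spins in `Λ` are independent, the spin at `x` having the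
one-site law `ν_x = ν.tilted (y ↦ -β H_{{x}}(η[x ↦ y]))`, and this one-site law coincides with
`ν.tilted (y ↦ -β H_{{x}}(σ[x ↦ y]))` for every configuration `σ` agreeing with `η` off `Λ`.
Hence the Efron–Stein inequality (tree `Literature.Probability.Moments.EfronSteinInequality_holds`)
gives `Var_{γ_Λ(·|η)} F ≤ ½ Σ_{x ∈ Λ} E_{γ_Λ(·|η)} ∫ (F σ − F(σ[x ↦ y]))² dν_x^σ(y)`.

## Contents (theorems only, namespace `GibbsSparseEfronStein` for the helpers)

* `tilted_pi_sum_eq_pi_tilted` — a product measure tilted by a sum of one-coordinate functions is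
  the product of the tilted factors (the normalisers multiply).
* `hamiltonianIn_eq_sum_sum` — in a sparse volume `H_Λ = Σ_{x ∈ Λ} Σ_{A ∈ supp Λ, x ∈ A} Φ_A`;
  `hamiltonianIn_singleton_eq_sum` — `H_{{x}} = Σ_{A ∈ supp Λ, x ∈ A} Φ_A` for `x ∈ Λ`;
  `apply_congr_of_sparse`, `hamiltonianIn_singleton_congr` — in a sparse volume an interaction
  term through `x ∈ Λ` only reads the spin at `x` and the spins off `Λ`.
* `integral_sub_sq_kernel_le_of_factorises` — the abstract kernel statement: if the tilt
  factorises over the glued coordinates, the kernel is the push-forward of a product of tilted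
  one-site laws and Efron–Stein applies with constant `½`.
* `stub_gibbsSparseEfronStein` — the registered statement.
-/

noncomputable section

open MeasureTheory ProbabilityTheory
open Literature.Probability.LatticeModels

namespace Summit.QuantumFields.YangMills.Theorems.SusceptibilityToPoincare

namespace GibbsSparseEfronStein

/-! ### Products of tilted measures -/

/-- **A product measure tilted by a sum of one-coordinate functions is the product of the tilted
factors**: `(⊗ᵢ μᵢ).tilted (ζ ↦ Σᵢ hᵢ(ζᵢ)) = ⊗ᵢ (μᵢ.tilted hᵢ)` — the Boltzmann factor of a sum
is the product of the factors and the normalisers multiply (Fubini,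
`integral_fintype_prod_eq_prod`); both sides agree on measurable boxes (`Measure.pi_eq`).
[folklore] -/
theorem tilted_pi_sum_eq_pi_tilted {ι : Type*} [Fintype ι] {E : Type*} [MeasurableSpace E]
    (μ : ι → Measure E) [∀ i, SigmaFinite (μ i)] (h : ι → E → ℝ) :
    (Measure.pi μ).tilted (fun ζ => ∑ i, h i (ζ i)) = Measure.pi fun i => (μ i).tilted (h i) := by
  have hZ : ∫ ζ, Real.exp (∑ i, h i (ζ i)) ∂(Measure.pi μ) = ∏ i, ∫ y, Real.exp (h i y) ∂(μ i) := by
    simp_rw [Real.exp_sum]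
    exact integral_fintype_prod_eq_prod (fun i y => Real.exp (h i y))
  refine (Measure.pi_eq fun s hs => ?_).symm
  rw [tilted_apply_eq_ofReal_integral' _ (MeasurableSet.univ_pi hs), hZ]
  have hpt : ∀ ζ : ι → E, Real.exp (∑ i, h i (ζ i)) / ∏ i, ∫ y, Real.exp (h i y) ∂(μ i) =
      ∏ i, (Real.exp (h i (ζ i)) / ∫ y, Real.exp (h i y) ∂(μ i)) := fun ζ => by
    rw [Real.exp_sum, Finset.prod_div_distrib]
  simp_rw [hpt]
  rw [Measure.restrict_pi_pi, integral_fintype_prod_eq_prod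
      (fun i y => Real.exp (h i y) / ∫ y, Real.exp (h i y) ∂(μ i)),
    ENNReal.ofReal_prod_of_nonneg fun i _ => integral_nonneg fun y => by positivity]
  refine Finset.prod_congr rfl fun i _ => ?_
  rw [tilted_apply_eq_ofReal_integral' _ (hs i)]

/-! ### Combinatorics of a sparse volume -/

section Sparse

variable {V S : Type*} [DecidableEq V] {Φ : Potential V S} {supp : Finset V → Finset (Finset V)}
  {Λ : Finset V}

/-- In a sparse volume (every `A ∈ supp Λ` meets `Λ` in at most one site) the Hamiltonian
regroups over the sites: `H_Λ^Φ = Σ_{x ∈ Λ} Σ_{A ∈ supp Λ, x ∈ A} Φ_A` (each interaction set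
meeting `Λ` is counted exactly once, at its unique site in `Λ`) (Georgii 2011, (2.11)).
[folklore] -/
theorem hamiltonianIn_eq_sum_sum
    (hΛ : ∀ A ∈ supp Λ, ∀ x ∈ A, ∀ y ∈ A, x ∈ Λ → y ∈ Λ → x = y) (σ : V → S) :
    hamiltonianIn Φ supp Λ σ = ∑ x ∈ Λ, ∑ A ∈ supp Λ with x ∈ A, Φ A σ := by
  unfold hamiltonianIn
  have key : ∀ A ∈ supp Λ, (if (A ∩ Λ).Nonempty then Φ A σ else 0) =
      ∑ x ∈ Λ, if x ∈ A then Φ A σ else 0 := fun A hA => by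
    rw [Finset.sum_ite_mem, Finset.sum_const, nsmul_eq_mul]
    have hcard : (Λ ∩ A).card ≤ 1 := Finset.card_le_one.2 fun a ha b hb =>
      hΛ A hA a (Finset.mem_inter.1 ha).2 b (Finset.mem_inter.1 hb).2 (Finset.mem_inter.1 ha).1
        (Finset.mem_inter.1 hb).1
    split_ifs with hne
    · have h1 : (Λ ∩ A).card = 1 :=
        le_antisymm hcard (Finset.card_pos.2 (by rwa [Finset.inter_comm]))
      rw [h1, Nat.cast_one, one_mul]
    · have h0 : Λ ∩ A = ∅ := by
        rw [Finset.inter_comm]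
        exact Finset.not_nonempty_iff_eq_empty.1 hne
      rw [h0, Finset.card_empty, Nat.cast_zero, zero_mul]
  calc ∑ A ∈ supp Λ with (A ∩ Λ).Nonempty, Φ A σ
      = ∑ A ∈ supp Λ, if (A ∩ Λ).Nonempty then Φ A σ else 0 := Finset.sum_filter _ _
    _ = ∑ A ∈ supp Λ, ∑ x ∈ Λ, if x ∈ A then Φ A σ else 0 := Finset.sum_congr rfl key
    _ = ∑ x ∈ Λ, ∑ A ∈ supp Λ, if x ∈ A then Φ A σ else 0 := Finset.sum_comm
    _ = ∑ x ∈ Λ, ∑ A ∈ supp Λ with x ∈ A, Φ A σ :=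
        Finset.sum_congr rfl fun x _ => (Finset.sum_filter _ _).symm

/-- For a potential supported by `supp` and a site `x ∈ Λ`, the one-site Hamiltonian is
`H_{{x}}^Φ = Σ_{A ∈ supp Λ, x ∈ A} Φ_A`: an interaction set through `x` with `Φ_A ≠ 0` meets both
`{x}` and `Λ`, hence lies in `supp {x}` and in `supp Λ` (`Potential.IsSupportedBy`)
(Georgii 2011, (2.11)). [folklore] -/
theorem hamiltonianIn_singleton_eq_sum (hsupp : Φ.IsSupportedBy supp) {x : V} (hx : x ∈ Λ)
    (τ : V → S) : hamiltonianIn Φ supp {x} τ = ∑ A ∈ supp Λ with x ∈ A, Φ A τ := by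
  rw [hamiltonianIn_eq_sum_filter_of_subset hsupp (Λ := {x}) (T := supp {x} ∪ supp Λ)
    Finset.subset_union_left τ]
  symm
  refine Finset.sum_subset (fun A hA => ?_) fun A hA2 hA1 => ?_
  · rw [Finset.mem_filter] at hA ⊢
    exact ⟨Finset.mem_union_right _ hA.1, x, Finset.mem_inter.2 ⟨hA.2, Finset.mem_singleton_self x⟩⟩
  · rw [Finset.mem_filter] at hA2 hA1
    obtain ⟨z, hz⟩ := hA2.2
    rw [Finset.mem_inter, Finset.mem_singleton] at hz
    obtain ⟨hzA, rfl⟩ := hz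
    by_contra hne
    exact hA1 ⟨hsupp Λ A ⟨z, Finset.mem_inter.2 ⟨hzA, hx⟩⟩ fun h0 => hne (congrFun h0 τ), hzA⟩

/-- In a sparse volume, an interaction term `Φ_A` with `A ∈ supp Λ` through a site `x ∈ Λ` reads
only the spin at `x` and the spins off `Λ` (adaptedness: `Φ_A` depends on the spins in `A`, and
`A ∩ Λ = {x}`). [folklore] -/
theorem apply_congr_of_sparse (hdep : ∀ A, DependsOn (Φ A) (↑A : Set V))
    (hΛ : ∀ A ∈ supp Λ, ∀ x ∈ A, ∀ y ∈ A, x ∈ Λ → y ∈ Λ → x = y) {A : Finset V}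
    (hA : A ∈ supp Λ) {x : V} (hxA : x ∈ A) (hxΛ : x ∈ Λ) {σ σ' : V → S} (hxe : σ x = σ' x)
    (hoff : ∀ z, z ∉ Λ → σ z = σ' z) : Φ A σ = Φ A σ' :=
  hdep A fun z hz => by
    by_cases hzΛ : z ∈ Λ
    · rw [← hΛ A hA x hxA z (Finset.mem_coe.1 hz) hxΛ hzΛ]
      exact hxe
    · exact hoff z hzΛ

/-- In a sparse volume, the one-site Hamiltonian `H_{{x}}^Φ` at a site `x ∈ Λ` reads only the
spin at `x` and the spins off `Λ`. [folklore] -/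
theorem hamiltonianIn_singleton_congr (hdep : ∀ A, DependsOn (Φ A) (↑A : Set V))
    (hsupp : Φ.IsSupportedBy supp)
    (hΛ : ∀ A ∈ supp Λ, ∀ x ∈ A, ∀ y ∈ A, x ∈ Λ → y ∈ Λ → x = y) {x : V} (hx : x ∈ Λ)
    {σ σ' : V → S} (hxe : σ x = σ' x) (hoff : ∀ z, z ∉ Λ → σ z = σ' z) :
    hamiltonianIn Φ supp {x} σ = hamiltonianIn Φ supp {x} σ' := by
  rw [hamiltonianIn_singleton_eq_sum hsupp hx σ, hamiltonianIn_singleton_eq_sum hsupp hx σ']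
  exact Finset.sum_congr rfl fun A hA =>
    apply_congr_of_sparse hdep hΛ (Finset.mem_filter.1 hA).1 (Finset.mem_filter.1 hA).2 hx hxe hoff

end Sparse

/-! ### The abstract kernel statement -/

section Kernel

variable {V S : Type*} [DecidableEq V] [Countable V] [MeasurableSpace S]
  [MeasurableSingletonClass S]

/-- **Efron–Stein inside a Gibbsian kernel whose tilt factorises.** Let `λ` be a probability
measure on `S`, `Λ` a finite volume, `η` a boundary condition, `φ` a measurable tilt with
`φ(ζ η_{Λᶜ}) = Σ_{x ∈ Λ} h_x(ζ_x)` for bounded measurable one-site tilts `h_x`, and `K_x^σ` one-site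
tilts equal to `h_x` for every `σ` agreeing with `η` off `Λ`. Then the kernel
`κ = (λ^{⊗Λ} ∘ glueWith⁻¹(·, η)).tilted φ` is the push-forward of the product of the tilted
one-site laws `λ.tilted h_x` (`tilted_pi_sum_eq_pi_tilted`), and for bounded measurable `F`,
`∫ (F − κF)² dκ ≤ ½ Σ_{x ∈ Λ} ∫∫ (F σ − F(σ[x ↦ y]))² d(λ.tilted K_x^σ)(y) dκ(σ)`
(Efron–Stein, `EfronSteinInequality_holds`; properness of `κ`,
`ae_eq_of_not_mem_tilted_map_glueWith_pi`). [folklore] -/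
theorem integral_sub_sq_kernel_le_of_factorises (lam : Measure S) [IsProbabilityMeasure lam]
    (Λ : Finset V) (η : V → S) (φ : (V → S) → ℝ) (h : V → S → ℝ) (K : V → (V → S) → S → ℝ)
    (hφ : Measurable φ) (hhm : ∀ x, Measurable (h x)) (hhb : ∀ x, ∃ C, ∀ y, |h x y| ≤ C)
    (hfac : ∀ ζ : Λ → S, φ (glueWith Λ ζ η) = ∑ x : Λ, h (↑x) (ζ x))
    (hK : ∀ σ : V → S, (∀ z, z ∉ Λ → σ z = η z) → ∀ x ∈ Λ, K x σ = h x)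
    {F : (V → S) → ℝ} (hF : Measurable F) {M : ℝ} (hM : ∀ σ, |F σ| ≤ M) :
    ∫ σ, (F σ - ∫ σ', F σ'
        ∂(((Measure.pi fun _ : Λ => lam).map (glueWith Λ · η)).tilted φ)) ^ 2
        ∂(((Measure.pi fun _ : Λ => lam).map (glueWith Λ · η)).tilted φ) ≤
      (1 / 2 : ℝ) * ∑ x ∈ Λ, ∫ σ, ∫ y, (F σ - F (Function.update σ x y)) ^ 2
        ∂(lam.tilted (K x σ)) ∂(((Measure.pi fun _ : Λ => lam).map (glueWith Λ · η)).tilted φ) := by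
  set κ : Measure (V → S) := ((Measure.pi fun _ : Λ => lam).map (glueWith Λ · η)).tilted φ with hκ
  set Q : Measure (Λ → S) := Measure.pi fun x : Λ => lam.tilted (h ↑x) with hQ
  have hg : Measurable fun ζ : Λ → S => glueWith Λ ζ η := measurable_glueWith Λ η
  -- the one-site laws are probability measures
  haveI hμ : ∀ x : Λ, IsProbabilityMeasure (lam.tilted (h ↑x)) := fun x => by
    obtain ⟨C, hC⟩ := hhb ↑x
    refine isProbabilityMeasure_tilted (Integrable.of_bound (hhm ↑x).exp.aestronglyMeasurable
      (Real.exp C) (ae_of_all _ fun y => ?_))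
    rw [Real.norm_eq_abs, Real.abs_exp, Real.exp_le_exp]
    exact (le_abs_self _).trans (hC y)
  -- the tilted product is the product of the tilted one-site laws
  have hprod : (Measure.pi fun _ : Λ => lam).tilted (fun ζ => φ (glueWith Λ ζ η)) = Q := by
    rw [show (fun ζ : Λ → S => φ (glueWith Λ ζ η)) = fun ζ => ∑ x : Λ, h (↑x) (ζ x) from
      funext hfac]
    exact tilted_pi_sum_eq_pi_tilted (fun _ : Λ => lam) (fun x : Λ => h ↑x)
  -- transport of integrals along the gluing map
  have htr : ∀ ψ : (V → S) → ℝ, Measurable ψ →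
      ∫ σ, ψ σ ∂κ = ∫ ζ, ψ (glueWith Λ ζ η) ∂Q := fun ψ hψ => by
    rw [hκ, LocalPoincare.integral_tilted_map_eq hg hφ hψ, hprod]
  -- Efron–Stein on the product of the one-site laws
  have hmem : MemLp (fun ζ : Λ → S => F (glueWith Λ ζ η)) 2 Q :=
    MemLp.of_bound (hF.comp hg).aestronglyMeasurable M
      (ae_of_all _ fun ζ => by simpa only [Real.norm_eq_abs] using hM _)
  have hES := Literature.Probability.Moments.EfronSteinInequality_holds (↥Λ) (fun _ => S)
    (fun x : Λ => lam.tilted (h ↑x)) (fun ζ => F (glueWith Λ ζ η)) (hF.comp hg) hmem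
  -- the left-hand side is the variance on the product space
  have hlhs : ∫ σ, (F σ - ∫ σ', F σ' ∂κ) ^ 2 ∂κ =
      variance (fun ζ : Λ → S => F (glueWith Λ ζ η)) Q := by
    rw [htr F hF, htr _ ((hF.sub_const _).pow_const 2),
      ProbabilityTheory.variance_eq_integral (X := fun ζ : Λ → S => F (glueWith Λ ζ η))
        (hF.comp hg).aemeasurable]
  -- the right-hand side, termwise
  have hae : ∀ᵐ σ ∂κ, ∀ z, z ∉ Λ → σ z = η z :=
    ae_eq_of_not_mem_tilted_map_glueWith_pi lam Λ η φ
  have hrhs : ∀ x : Λ, ∫ σ, ∫ y, (F σ - F (Function.update σ ↑x y)) ^ 2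
      ∂(lam.tilted (K ↑x σ)) ∂κ = ∫ ζ, ∫ y, (F (glueWith Λ ζ η) -
        F (glueWith Λ (Function.update ζ x y) η)) ^ 2 ∂(lam.tilted (h ↑x)) ∂Q := fun x => by
    have h1 : ∫ σ, ∫ y, (F σ - F (Function.update σ ↑x y)) ^ 2 ∂(lam.tilted (K ↑x σ)) ∂κ =
        ∫ σ, ∫ y, (F σ - F (Function.update σ ↑x y)) ^ 2 ∂(lam.tilted (h ↑x)) ∂κ :=
      integral_congr_ae (hae.mono fun σ hσ => by
        dsimp only
        rw [hK σ hσ ↑x x.2])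
    have hDm : Measurable fun q : (V → S) × S =>
        (F q.1 - F (Function.update q.1 (↑x) q.2)) ^ 2 :=
      ((hF.comp measurable_fst).sub (hF.comp measurable_update')).pow_const 2
    have hΨm : Measurable fun σ : V → S =>
        ∫ y, (F σ - F (Function.update σ (↑x) y)) ^ 2 ∂(lam.tilted (h ↑x)) :=
      (hDm.stronglyMeasurable.integral_prod_right' (ν := lam.tilted (h ↑x))).measurable
    rw [h1, htr _ hΨm]
    simp only [LocalPoincare.glueWith_update]
  -- assemble
  rw [hlhs, ← Finset.sum_coe_sort Λ]
  refine hES.trans_eq ?_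
  congr 1
  exact Finset.sum_congr rfl fun x _ => (hrhs x).symm

end Kernel

end GibbsSparseEfronStein

/-! ### The registered stub -/

/-- `stub_gibbsSparseEfronStein` — **Efron–Stein in a sparse Gibbsian kernel** (registered stub T0
of line `planted-link-pinning`): for a countable site set, a spin space with measurable singletons,
an a priori probability measure `ν`, an adapted potential `Φ` with bounded terms supported by the
finite families `supp`, and a finite volume `Λ` that is SPARSE (every `A ∈ supp Λ` meets `Λ` in
at most one site), the Gibbs distribution `γ_Λ(· | η)` of `gibbsSpecOfPotential ν Φ supp β`
(Georgii 2011, Def. 2.9) makes the spins in `Λ` independent with one-site laws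
`ν.tilted (y ↦ -β H_{{x}}(σ[x ↦ y]))` (the same for all `σ` agreeing with `η` off `Λ`), so for
every bounded measurable `F`,
`∫ (F − γ_Λ F)² dγ_Λ(·|η) ≤ ½ Σ_{x ∈ Λ} ∫∫ (F σ − F(σ[x ↦ y]))² dν_x^σ(y) dγ_Λ(σ|η)` with
`ν_x^σ = ν.tilted (−β H_{{x}}(σ[x ↦ ·]))`
(Efron–Stein 1981 / Steele 1986 with constant `½`). [folklore] -/
theorem stub_gibbsSparseEfronStein :
    ∀ (V : Type) (X : Type) [DecidableEq V] [Countable V] [MeasurableSpace X]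
      [MeasurableSingletonClass X] (ν : MeasureTheory.Measure X) [IsProbabilityMeasure ν]
      (Φ : Literature.Probability.LatticeModels.Potential V X) (supp : Finset V → Finset (Finset V))
      (β : ℝ), Φ.IsAdapted → (∀ A, ∃ C : ℝ, ∀ σ, |Φ A σ| ≤ C) → Φ.IsSupportedBy supp →
      ∀ (Λ : Finset V), (∀ A ∈ supp Λ, ∀ x ∈ A, ∀ y ∈ A, x ∈ Λ → y ∈ Λ → x = y) →
      ∀ (η : V → X) (F : (V → X) → ℝ), Measurable F → (∃ M : ℝ, ∀ σ, |F σ| ≤ M) →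
        ∫ σ, (F σ - ∫ τ, F τ
            ∂(Literature.Probability.LatticeModels.gibbsSpecOfPotential ν Φ supp β Λ η)) ^ 2
          ∂(Literature.Probability.LatticeModels.gibbsSpecOfPotential ν Φ supp β Λ η) ≤
        (1 / 2 : ℝ) * ∑ x ∈ Λ, ∫ σ, ∫ y, (F σ - F (Function.update σ x y)) ^ 2
            ∂(ν.tilted fun y' => -β *
              Literature.Probability.LatticeModels.hamiltonianIn Φ supp {x} (Function.update σ x y'))
          ∂(Literature.Probability.LatticeModels.gibbsSpecOfPotential ν Φ supp β Λ η) := by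
  intro V X _ _ _ _ ν _ Φ supp β hΦ hΦb hsupp Λ hΛ η F hF hFb
  obtain ⟨M, hM⟩ := hFb
  choose C hC using hΦb
  have hHm : ∀ Δ : Finset V, Measurable (hamiltonianIn Φ supp Δ) := fun Δ =>
    measurable_hamiltonianIn (fun A => (hΦ A).2) supp Δ
  have hdep : ∀ A, DependsOn (Φ A) (↑A : Set V) := fun A => (hΦ A).1
  -- factorisation of the tilt over the glued coordinates
  have hfac : ∀ ζ : Λ → X, -β * hamiltonianIn Φ supp Λ (glueWith Λ ζ η) =
      ∑ x : Λ, -β * hamiltonianIn Φ supp {(↑x : V)} (Function.update η ↑x (ζ x)) := fun ζ => by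
    rw [GibbsSparseEfronStein.hamiltonianIn_eq_sum_sum hΛ (glueWith Λ ζ η), Finset.mul_sum,
      ← Finset.sum_coe_sort Λ]
    refine Finset.sum_congr rfl fun x _ => ?_
    rw [GibbsSparseEfronStein.hamiltonianIn_singleton_eq_sum hsupp x.2]
    congr 1
    refine Finset.sum_congr rfl fun A hA => GibbsSparseEfronStein.apply_congr_of_sparse hdep hΛ
      (Finset.mem_filter.1 hA).1 (Finset.mem_filter.1 hA).2 x.2 ?_ fun z hz => ?_
    · rw [Function.update_self, glueWith_apply_mem _ _ _ x.2]
    · have hzx : z ≠ ↑x := fun hzx => hz (hzx ▸ x.2)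
      rw [Function.update_of_ne hzx, glueWith_apply_not_mem _ _ _ hz]
  -- the one-site tilts do not see the other spins of `Λ`
  have hK : ∀ σ : V → X, (∀ z, z ∉ Λ → σ z = η z) → ∀ x ∈ Λ,
      (fun y' => -β * hamiltonianIn Φ supp {x} (Function.update σ x y')) =
        fun y' => -β * hamiltonianIn Φ supp {x} (Function.update η x y') :=
    fun σ hσ x hx => funext fun y' => by
      rw [GibbsSparseEfronStein.hamiltonianIn_singleton_congr hdep hsupp hΛ hx
        (σ := Function.update σ x y') (σ' := Function.update η x y')
        (by rw [Function.update_self, Function.update_self])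
        fun z hz => by
          have hzx : z ≠ x := fun hzx => hz (hzx ▸ hx)
          rw [Function.update_of_ne hzx, Function.update_of_ne hzx, hσ z hz]]
  exact GibbsSparseEfronStein.integral_sub_sq_kernel_le_of_factorises ν Λ η
    (fun σ => -β * hamiltonianIn Φ supp Λ σ)
    (fun x y => -β * hamiltonianIn Φ supp {x} (Function.update η x y))
    (fun x σ y' => -β * hamiltonianIn Φ supp {x} (Function.update σ x y'))
    ((hHm Λ).const_mul _) (fun x => ((hHm {x}).comp (measurable_update η)).const_mul _)
    (fun x => ⟨|β| * ∑ A ∈ supp {x} with (A ∩ {x}).Nonempty, C A, fun y => by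
      rw [abs_mul, abs_neg]
      exact mul_le_mul_of_nonneg_left (abs_hamiltonianIn_le hC supp {x} _) (abs_nonneg β)⟩)
    hfac hK hF hM

end Summit.QuantumFields.YangMills.Theorems.SusceptibilityToPoincare

end
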